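import Summits.QuantumFields.YangMills.Theorems.IR.EsPolymerESMeasures

/-!
# Crux `IR` (item stmt-QuantumFields-19354) — line «es-polymer-decoupling»: THE RUNG `stub_esRung : ESRung`, proved

Helper module for item `stmt-QuantumFields-19354` (`--supports … --as helper`; lead prover ym-ir-line-mxc-p1 g2).  It proves
the registered stub `stub_esRung : ESRung` of `Cruxes/IR/Lines/es_polymer_decoupling.lean` VERBATIM: for every compact
`G`, every continuous unitary-matrix representation `ρ` and every Peierls parameter `p > 0` there is `β₀(p) > 0` such that
for `|β| ≤ β₀` and every torus `(2S+1)⁴` the Wilson measure has a decoupling–polymer representation `DPR ρ β S 1 p` at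
mesh `1` (cells = sites).

The witnesses are the Edwards–Sokal / Kandel–Domany sub-measures `esSub` of `Theorems/IR/EsPolymerESMeasures.lean` with
floor `m = e^{−D}`, ceiling `M = e^{D}`, `D = |β| · #{plaquette orientations} · (n + sup |Re tr ρ|)`, activities `esAct`
and normaliser `esZ`; clause (P) is `mass_esSub`; clauses (I) and (D) (`esSub_indep`, `esSub_owner`, §2) are the
three-block factorisation of product Haar measure over the cell sets `ball(c_A,1) ∪ owner`, `ball(c_B,1) ∪ owner`, rest
(pairwise cell distance `≥ 2`: blocks `≥ 4` apart, non-owner polymers `≥ 3` from the centre (`three_le_cellDist_of_ne_owner`),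
distinct polymers `≥ 7` apart), using `integral_mul_eq_of_cells` of `Theorems/IR/EsPolymerTorusCells.lean`.

HONEST FRAMING: this is the strong-coupling (small `|β|`) rung of a CONDITIONAL rung line; the load-bearing statement of
the line (`IRPolymerCert`) and the Yang–Mills mass gap are NOT proved here, and `PolymerEngine` as registered is reported
misstated (evidence on the item). -/

set_option autoImplicit false

noncomputable section

open MeasureTheory ProbabilityTheory Finset Function
open scoped NNReal ENNReal
open Literature.MathematicalPhysics.QuantumFieldTheory

namespace Summit.QuantumFields.YangMills.Cruxes.IR.EsPolymer

/-! ## §1 Owners and blocks: the cell-distance bookkeeping -/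

/-- The cells of a polymer of `Γ` other than the owner of `c` are at cell distance `≥ 3` from `c`. -/
theorem three_le_cellDist_of_ne_owner {q : ℕ} {Γ : Finset (Finset (Cell q))} (hΓ : Compatible Γ) {c : Cell q}
    {γ : Finset (Cell q)} (hγ : γ ∈ Γ) (hne : γ ≠ owner Γ c) {y : Cell q} (hy : y ∈ γ) : 3 ≤ cellDist c y := by
  classical
  by_contra hlt
  rw [not_le] at hlt
  have hmem : γ ∈ Γ.filter fun γ' => ∃ c' ∈ γ', cellDist c c' ≤ 2 := mem_filter.2 ⟨hγ, y, hy, by omega⟩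
  have hsub : γ ⊆ owner Γ c := Finset.le_sup (f := id) hmem
  obtain ⟨ho, -⟩ := owner_mem_of_ne_empty hΓ (ne_empty_of_mem (hsub hy))
  have h7 := hΓ.2 γ hγ (owner Γ c) ho hne y hy y (hsub hy)
  have := cellDist_self y
  omega

/-- `owner Γ c ∈ Γ` or `owner Γ c = ∅`. -/
theorem owner_mem_or_eq_empty {q : ℕ} {Γ : Finset (Finset (Cell q))} (hΓ : Compatible Γ) (c : Cell q) :
    owner Γ c ∈ Γ ∨ owner Γ c = ∅ := by
  by_cases h : owner Γ c = ∅
  · exact Or.inr h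
  · exact Or.inl (owner_mem_of_ne_empty hΓ h).1

/-- A nonempty owner is a polymer of `Γ`. -/
theorem owner_mem_of_mem {q : ℕ} {Γ : Finset (Finset (Cell q))} (hΓ : Compatible Γ) {c x : Cell q}
    (hx : x ∈ owner Γ c) : owner Γ c ∈ Γ :=
  (owner_mem_of_ne_empty hΓ (ne_empty_of_mem hx)).1

/-- A cell within `1` of `c`, or in the owner of `c`, is at distance `≥ 2` from every cell of every OTHER polymer. -/
theorem two_le_cellDist_of_ne_owner {q : ℕ} {Γ : Finset (Finset (Cell q))} (hΓ : Compatible Γ) {c x y : Cell q}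
    {γ : Finset (Cell q)} (hx : cellDist c x ≤ 1 ∨ x ∈ owner Γ c) (hγ : γ ∈ Γ) (hne : γ ≠ owner Γ c)
    (hy : y ∈ γ) : 2 ≤ cellDist x y := by
  rcases hx with hx | hx
  · have h3 := three_le_cellDist_of_ne_owner hΓ hγ hne hy
    have := cellDist_triangle c x y
    omega
  · have h7 := hΓ.2 (owner Γ c) (owner_mem_of_mem hΓ hx) γ hγ hne.symm x hx y hy
    omega

/-- The two block-plus-owner cell sets of clause (I) are at distance `≥ 2`. -/
theorem two_le_cellDist_blocks {q : ℕ} {Γ : Finset (Finset (Cell q))} (hΓ : Compatible Γ) {cA cB x y : Cell q}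
    (h4 : 4 ≤ cellDist cA cB) (hown : owner Γ cA ≠ owner Γ cB ∨ (owner Γ cA = ∅ ∧ owner Γ cB = ∅))
    (hx : cellDist cA x ≤ 1 ∨ x ∈ owner Γ cA) (hy : cellDist cB y ≤ 1 ∨ y ∈ owner Γ cB) : 2 ≤ cellDist x y := by
  rcases hy with hy | hy
  · rcases hx with hx | hx
    · have h1 := cellDist_triangle cA x cB
      have h2 := cellDist_triangle x y cB
      rw [cellDist_comm cB y] at hy
      omega
    · have hne : owner Γ cA ≠ owner Γ cB :=
        hown.elim id fun h => absurd hx (by rw [h.1]; exact notMem_empty _)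
      have := two_le_cellDist_of_ne_owner hΓ (Or.inl hy) (owner_mem_of_mem hΓ hx) hne hx
      rwa [cellDist_comm] at this
  · have hne : owner Γ cB ≠ owner Γ cA :=
      hown.elim (fun h h' => h h'.symm) fun h => absurd hy (by rw [h.2]; exact notMem_empty _)
    exact two_le_cellDist_of_ne_owner hΓ hx (owner_mem_of_mem hΓ hy) hne hy

/-- The product of two functions reading the coordinates in `s`, `t` reads the coordinates in `s ∪ t`. -/
theorem dependsOn_mul {ι α : Type*} {X Y : (ι → α) → ℝ} {s t : Set ι} (hX : DependsOn X s) (hY : DependsOn Y t) :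
    DependsOn (fun U => X U * Y U) (s ∪ t) := fun _ _ h => by
  dsimp only
  rw [hX fun i hi => h i (Or.inl hi), hY fun i hi => h i (Or.inr hi)]

variable {N : ℕ} [NeZero N] {G : Type}

/-- An observable of the radius-`1` block about `c` (mesh `1`) reads only the links of the cells within `1` of `c`. -/
theorem dependsOn_block_of_blockEdges {A : GaugeConfig 4 N G → ℝ} {c : Cell N}
    (hA : DependsOn A (blockEdges N N (fun _ j => j) c 1)) :
    DependsOn A (↑((Finset.univ.filter fun c' : Cell N => cellDist c c' ≤ 1).biUnion cellLinks) : Set (Edge 4 N)) := by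
  refine DependsOn.mono (fun e he => ?_) hA
  obtain ⟨c', hc', he⟩ := he
  rw [torusCellEdges_unit, Finset.mem_image] at he
  obtain ⟨i, -, rfl⟩ := he
  exact Finset.mem_coe.2 (Finset.mem_biUnion.2 ⟨c', Finset.mem_filter.2 ⟨Finset.mem_univ _, hc'⟩, base_mem_cellLinks c' i⟩)

variable [Group G] [TopologicalSpace G] [IsTopologicalGroup G] [CompactSpace G] [MeasurableSpace G] [BorelSpace G]
  {n : ℕ} {ρ : G →* Matrix (Fin n) (Fin n) ℂ} {β m : ℝ}

/-! ## §2 Factorisation of product Haar measure over separated cell sets; clauses (I) and (D) -/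

/-- `integral_mul_eq_of_cells` with `DependsOn` hypotheses. -/
theorem integral_mul_eq_of_dependsOn {K₁ K₂ : Finset (Cell N)} (h : ∀ c ∈ K₁, ∀ c' ∈ K₂, 2 ≤ cellDist c c')
    {X Y : GaugeConfig 4 N G → ℝ} (hX : DependsOn X (↑(K₁.biUnion cellLinks) : Set (Edge 4 N))) (hXm : Measurable X)
    (hY : DependsOn Y (↑(K₂.biUnion cellLinks) : Set (Edge 4 N))) (hYm : Measurable Y) :
    ∫ U, X U * Y U ∂(Measure.pi fun _ : Edge 4 N => haarProbability G) =
      (∫ U, X U ∂(Measure.pi fun _ : Edge 4 N => haarProbability G)) *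
        ∫ U, Y U ∂(Measure.pi fun _ : Edge 4 N => haarProbability G) :=
  integral_mul_eq_of_cells (haarProbability G) h (measurable_iSup_of_dependsOn hXm hX)
    (measurable_iSup_of_dependsOn hYm hY)

/-- Three-block factorisation over pairwise separated cell sets. -/
theorem integral_mul_mul_eq_of_dependsOn {K₁ K₂ K₃ : Finset (Cell N)}
    (h₁₂ : ∀ c ∈ K₁, ∀ c' ∈ K₂, 2 ≤ cellDist c c') (h₁₃ : ∀ c ∈ K₁, ∀ c' ∈ K₃, 2 ≤ cellDist c c')
    (h₂₃ : ∀ c ∈ K₂, ∀ c' ∈ K₃, 2 ≤ cellDist c c') {X Y R : GaugeConfig 4 N G → ℝ}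
    (hX : DependsOn X (↑(K₁.biUnion cellLinks) : Set (Edge 4 N))) (hXm : Measurable X)
    (hY : DependsOn Y (↑(K₂.biUnion cellLinks) : Set (Edge 4 N))) (hYm : Measurable Y)
    (hR : DependsOn R (↑(K₃.biUnion cellLinks) : Set (Edge 4 N))) (hRm : Measurable R) :
    ∫ U, X U * Y U * R U ∂(Measure.pi fun _ : Edge 4 N => haarProbability G) =
      (∫ U, X U ∂(Measure.pi fun _ : Edge 4 N => haarProbability G)) *
        (∫ U, Y U ∂(Measure.pi fun _ : Edge 4 N => haarProbability G)) *
          ∫ U, R U ∂(Measure.pi fun _ : Edge 4 N => haarProbability G) := by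
  classical
  have hXY : DependsOn (fun U => X U * Y U) (↑((K₁ ∪ K₂).biUnion cellLinks) : Set (Edge 4 N)) :=
    DependsOn.mono (Set.union_subset
      (Finset.coe_subset.2 (biUnion_subset_biUnion_of_subset_left _ subset_union_left))
      (Finset.coe_subset.2 (biUnion_subset_biUnion_of_subset_left _ subset_union_right))) (dependsOn_mul hX hY)
  have hsep : ∀ c ∈ K₁ ∪ K₂, ∀ c' ∈ K₃, 2 ≤ cellDist c c' := fun c hc c' hc' =>
    (mem_union.1 hc).elim (fun h => h₁₃ c h c' hc') fun h => h₂₃ c h c' hc'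
  rw [integral_mul_eq_of_dependsOn hsep hXY (hXm.mul hYm) hR hRm, integral_mul_eq_of_dependsOn h₁₂ hX hXm hY hYm]

/-- Integration against the sub-measure of a retained set. -/
theorem integral_esSub' (hρ : Continuous ρ) (hm : 0 < m) {M : ℝ}
    (hW : ∀ (c : Cell N) (U : GaugeConfig 4 N G), m ≤ cellWeight ρ β c U ∧ cellWeight ρ β c U ≤ M)
    (ω : Finset (Cell N)) (X : GaugeConfig 4 N G → ℝ) :
    ∫ U, X U ∂(esSub' ρ β m ω) =
      ∫ U, polyFactor ρ β m ω U / esZ (N := N) ρ β m * X U ∂(Measure.pi fun _ : Edge 4 N => haarProbability G) := by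
  have hZ : 0 < esZ (N := N) ρ β m :=
    lt_of_lt_of_le zero_lt_one (one_le_esZ hρ hm (fun c U => (hW c U).1) fun c U => cellFactor_le hm (hW c U).2)
  unfold esSub'
  rw [integral_withDensity_eq_integral_smul ((measurable_polyFactor hρ ω).div_const _).real_toNNReal]
  refine integral_congr_ae (ae_of_all _ fun U => ?_)
  dsimp only
  rw [NNReal.smul_def, smul_eq_mul, Real.coe_toNNReal _ (div_nonneg (polyFactor_bounds hm hW ω U).1 hZ.le)]

/-- Integration against the sub-measure of a compatible family: density `esZ⁻¹ ∏_{γ∈Γ} F_γ`. -/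
theorem integral_esSub (hρ : Continuous ρ) (hm : 0 < m) {M : ℝ}
    (hW : ∀ (c : Cell N) (U : GaugeConfig 4 N G), m ≤ cellWeight ρ β c U ∧ cellWeight ρ β c U ≤ M)
    {Γ : Finset (Finset (Cell N))} (hΓ : Compatible Γ) (X : GaugeConfig 4 N G → ℝ) :
    ∫ U, X U ∂(esSub ρ β m Γ) = (esZ (N := N) ρ β m)⁻¹ *
      ∫ U, (∏ γ ∈ Γ, polyFactor ρ β m γ U) * X U ∂(Measure.pi fun _ : Edge 4 N => haarProbability G) := by
  rw [esSub_eq_of_compatible hΓ, integral_esSub' hρ hm hW, ← integral_const_mul]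
  refine integral_congr_ae (ae_of_all _ fun U => ?_)
  dsimp only
  rw [polyFactor_biUnion hΓ, div_eq_inv_mul, mul_assoc]

/-- The mass of a compatible family as `esZ⁻¹ ∫ ∏_{γ∈Γ} F_γ`. -/
theorem mass_esSub_eq_integral (hρ : Continuous ρ) (hm : 0 < m) {M : ℝ}
    (hW : ∀ (c : Cell N) (U : GaugeConfig 4 N G), m ≤ cellWeight ρ β c U ∧ cellWeight ρ β c U ≤ M)
    {Γ : Finset (Finset (Cell N))} (hΓ : Compatible Γ) :
    (esSub (N := N) ρ β m Γ Set.univ).toReal = (esZ (N := N) ρ β m)⁻¹ *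
      ∫ U, ∏ γ ∈ Γ, polyFactor ρ β m γ U ∂(Measure.pi fun _ : Edge 4 N => haarProbability G) := by
  rw [mass_esSub hρ hm hW hΓ, integral_prod_polyFactor hρ hΓ]

omit [TopologicalSpace G] [IsTopologicalGroup G] [CompactSpace G] [MeasurableSpace G] [BorelSpace G] in
/-- Splitting one factor (a member, or the empty set whose factor is `1`) off the density of a family. -/
theorem prod_polyFactor_eq_mul_erase {Γ : Finset (Finset (Cell N))} {γ₀ : Finset (Cell N)} (h : γ₀ ∈ Γ ∨ γ₀ = ∅)
    (U : GaugeConfig 4 N G) :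
    ∏ γ ∈ Γ, polyFactor ρ β m γ U = polyFactor ρ β m γ₀ U * ∏ γ ∈ Γ.erase γ₀, polyFactor ρ β m γ U := by
  classical
  by_cases hmem : γ₀ ∈ Γ
  · exact (mul_prod_erase Γ _ hmem).symm
  · rw [erase_eq_of_notMem hmem, h.resolve_left hmem]
    simp [polyFactor]

/-- **Clause (I)**: conditionally on a compatible family, radius-`1` block observables at cell distance `≥ 4` with distinct
(or both empty) owners are uncorrelated. -/
theorem esSub_indep (hρ : Continuous ρ) (hm : 0 < m) {M : ℝ}
    (hW : ∀ (c : Cell N) (U : GaugeConfig 4 N G), m ≤ cellWeight ρ β c U ∧ cellWeight ρ β c U ≤ M)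
    {Γ : Finset (Finset (Cell N))} (hΓ : Compatible Γ) (cA cB : Cell N) (A B : GaugeConfig 4 N G → ℝ)
    (hAm : Measurable A) (hBm : Measurable B) (hA : DependsOn A (blockEdges N N (fun _ j => j) cA 1))
    (hB : DependsOn B (blockEdges N N (fun _ j => j) cB 1)) (h4 : 4 ≤ cellDist cA cB)
    (hown : owner Γ cA ≠ owner Γ cB ∨ (owner Γ cA = ∅ ∧ owner Γ cB = ∅)) :
    (esSub ρ β m Γ Set.univ).toReal * ∫ U, A U * B U ∂(esSub ρ β m Γ) =
      (∫ U, A U ∂(esSub ρ β m Γ)) * ∫ U, B U ∂(esSub ρ β m Γ) := by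
  classical
  -- the three factors of the density
  have ha : owner Γ cA ∈ Γ ∨ owner Γ cA = ∅ := owner_mem_or_eq_empty hΓ cA
  have hb : owner Γ cB ∈ Γ.erase (owner Γ cA) ∨ owner Γ cB = ∅ := by
    rcases owner_mem_or_eq_empty hΓ cB with hb | hb
    · rcases hown with hne | ⟨-, hb0⟩
      · exact Or.inl (mem_erase.2 ⟨hne.symm, hb⟩)
      · exact Or.inr hb0
    · exact Or.inr hb
  set Γ' : Finset (Finset (Cell N)) := (Γ.erase (owner Γ cA)).erase (owner Γ cB) with hΓ'
  have hΓ'c : Compatible Γ' := compatible_erase (compatible_erase hΓ _) _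
  have hD : ∀ U : GaugeConfig 4 N G, ∏ γ ∈ Γ, polyFactor ρ β m γ U =
      polyFactor ρ β m (owner Γ cA) U * polyFactor ρ β m (owner Γ cB) U * polyFactor ρ β m (Γ'.biUnion id) U :=
    fun U => by
      rw [prod_polyFactor_eq_mul_erase ha, prod_polyFactor_eq_mul_erase hb, polyFactor_biUnion hΓ'c, mul_assoc]
  -- the three cell sets and their separation
  set KA : Finset (Cell N) := (Finset.univ.filter fun c' : Cell N => cellDist cA c' ≤ 1) ∪ owner Γ cA with hKA
  set KB : Finset (Cell N) := (Finset.univ.filter fun c' : Cell N => cellDist cB c' ≤ 1) ∪ owner Γ cB with hKB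
  have memKA : ∀ x ∈ KA, cellDist cA x ≤ 1 ∨ x ∈ owner Γ cA := fun x hx => by
    simpa [hKA, mem_union, mem_filter] using hx
  have memKB : ∀ y ∈ KB, cellDist cB y ≤ 1 ∨ y ∈ owner Γ cB := fun y hy => by
    simpa [hKB, mem_union, mem_filter] using hy
  have memKR : ∀ y ∈ Γ'.biUnion id, ∃ γ ∈ Γ, γ ≠ owner Γ cA ∧ γ ≠ owner Γ cB ∧ y ∈ γ := fun y hy => by
    obtain ⟨γ, hγ, hyγ⟩ := mem_biUnion.1 hy
    obtain ⟨hγb, hγ'⟩ := mem_erase.1 hγ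
    obtain ⟨hγa, hγΓ⟩ := mem_erase.1 hγ'
    exact ⟨γ, hγΓ, hγa, hγb, hyγ⟩
  have hAB : ∀ x ∈ KA, ∀ y ∈ KB, 2 ≤ cellDist x y := fun x hx y hy =>
    two_le_cellDist_blocks hΓ h4 hown (memKA x hx) (memKB y hy)
  have hAR : ∀ x ∈ KA, ∀ y ∈ Γ'.biUnion id, 2 ≤ cellDist x y := fun x hx y hy => by
    obtain ⟨γ, hγ, hγa, -, hyγ⟩ := memKR y hy
    exact two_le_cellDist_of_ne_owner hΓ (memKA x hx) hγ hγa hyγ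
  have hBR : ∀ x ∈ KB, ∀ y ∈ Γ'.biUnion id, 2 ≤ cellDist x y := fun x hx y hy => by
    obtain ⟨γ, hγ, -, hγb, hyγ⟩ := memKR y hy
    exact two_le_cellDist_of_ne_owner hΓ (memKB x hx) hγ hγb hyγ
  -- what each factor reads
  have hFa : DependsOn (polyFactor (G := G) ρ β m (owner Γ cA)) (↑(KA.biUnion cellLinks) : Set (Edge 4 N)) :=
    (dependsOn_polyFactor _).mono (Finset.coe_subset.2 (biUnion_subset_biUnion_of_subset_left _ subset_union_right))
  have hFb : DependsOn (polyFactor (G := G) ρ β m (owner Γ cB)) (↑(KB.biUnion cellLinks) : Set (Edge 4 N)) :=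
    (dependsOn_polyFactor _).mono (Finset.coe_subset.2 (biUnion_subset_biUnion_of_subset_left _ subset_union_right))
  have hAd : DependsOn A (↑(KA.biUnion cellLinks) : Set (Edge 4 N)) :=
    (dependsOn_block_of_blockEdges hA).mono
      (Finset.coe_subset.2 (biUnion_subset_biUnion_of_subset_left _ subset_union_left))
  have hBd : DependsOn B (↑(KB.biUnion cellLinks) : Set (Edge 4 N)) :=
    (dependsOn_block_of_blockEdges hB).mono
      (Finset.coe_subset.2 (biUnion_subset_biUnion_of_subset_left _ subset_union_left))
  have hAFa : DependsOn (fun U => A U * polyFactor ρ β m (owner Γ cA) U) (↑(KA.biUnion cellLinks) : Set (Edge 4 N)) :=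
    (dependsOn_mul hAd hFa).mono (Set.union_subset subset_rfl subset_rfl)
  have hBFb : DependsOn (fun U => B U * polyFactor ρ β m (owner Γ cB) U) (↑(KB.biUnion cellLinks) : Set (Edge 4 N)) :=
    (dependsOn_mul hBd hFb).mono (Set.union_subset subset_rfl subset_rfl)
  have hR : DependsOn (polyFactor (G := G) ρ β m (Γ'.biUnion id)) (↑((Γ'.biUnion id).biUnion cellLinks) : Set (Edge 4 N)) :=
    dependsOn_polyFactor _
  have hFam := measurable_polyFactor (N := N) (β := β) (m := m) hρ (owner Γ cA)
  have hFbm := measurable_polyFactor (N := N) (β := β) (m := m) hρ (owner Γ cB)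
  have hRm := measurable_polyFactor (N := N) (β := β) (m := m) hρ (Γ'.biUnion id)
  -- the four factorisations
  have I1 := integral_mul_mul_eq_of_dependsOn hAB hAR hBR hFa hFam hFb hFbm hR hRm
  have I2 := integral_mul_mul_eq_of_dependsOn hAB hAR hBR hAFa (hAm.mul hFam) hBFb (hBm.mul hFbm) hR hRm
  have I3 := integral_mul_mul_eq_of_dependsOn hAB hAR hBR hAFa (hAm.mul hFam) hFb hFbm hR hRm
  have I4 := integral_mul_mul_eq_of_dependsOn hAB hAR hBR hFa hFam hBFb (hBm.mul hFbm) hR hRm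
  rw [mass_esSub_eq_integral hρ hm hW hΓ, integral_esSub hρ hm hW hΓ, integral_esSub hρ hm hW hΓ,
    integral_esSub hρ hm hW hΓ]
  simp_rw [hD]
  have e2 : ∀ U : GaugeConfig 4 N G,
      polyFactor ρ β m (owner Γ cA) U * polyFactor ρ β m (owner Γ cB) U * polyFactor ρ β m (Γ'.biUnion id) U *
          (A U * B U) =
        A U * polyFactor ρ β m (owner Γ cA) U * (B U * polyFactor ρ β m (owner Γ cB) U) *
          polyFactor ρ β m (Γ'.biUnion id) U := fun U => by ring
  have e3 : ∀ U : GaugeConfig 4 N G,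
      polyFactor ρ β m (owner Γ cA) U * polyFactor ρ β m (owner Γ cB) U * polyFactor ρ β m (Γ'.biUnion id) U * A U =
        A U * polyFactor ρ β m (owner Γ cA) U * polyFactor ρ β m (owner Γ cB) U *
          polyFactor ρ β m (Γ'.biUnion id) U := fun U => by ring
  have e4 : ∀ U : GaugeConfig 4 N G,
      polyFactor ρ β m (owner Γ cA) U * polyFactor ρ β m (owner Γ cB) U * polyFactor ρ β m (Γ'.biUnion id) U * B U =
        polyFactor ρ β m (owner Γ cA) U * (B U * polyFactor ρ β m (owner Γ cB) U) *
          polyFactor ρ β m (Γ'.biUnion id) U := fun U => by ring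
  simp_rw [e2, e3, e4]
  rw [I1, I2, I3, I4]
  ring

/-- **Clause (D)**: conditionally on a compatible family, the mean of a radius-`1` block observable depends on the family
only through the owner of the block's centre. -/
theorem esSub_owner (hρ : Continuous ρ) (hm : 0 < m) {M : ℝ}
    (hW : ∀ (c : Cell N) (U : GaugeConfig 4 N G), m ≤ cellWeight ρ β c U ∧ cellWeight ρ β c U ≤ M)
    (cA : Cell N) (A : GaugeConfig 4 N G → ℝ) (hAm : Measurable A)
    (hA : DependsOn A (blockEdges N N (fun _ j => j) cA 1)) :
    ∃ Φ : Finset (Cell N) → ℝ, ∀ Γ : Finset (Finset (Cell N)), Compatible Γ →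
      ∫ U, A U ∂(esSub ρ β m Γ) = (esSub ρ β m Γ Set.univ).toReal * Φ (owner Γ cA) := by
  classical
  refine ⟨fun γ => (∫ U, A U * polyFactor ρ β m γ U ∂(Measure.pi fun _ : Edge 4 N => haarProbability G)) /
    esAct (N := N) ρ β m γ, fun Γ hΓ => ?_⟩
  have ha : owner Γ cA ∈ Γ ∨ owner Γ cA = ∅ := owner_mem_or_eq_empty hΓ cA
  set Γ' : Finset (Finset (Cell N)) := Γ.erase (owner Γ cA) with hΓ'
  have hΓ'c : Compatible Γ' := compatible_erase hΓ _
  have hD : ∀ U : GaugeConfig 4 N G, ∏ γ ∈ Γ, polyFactor ρ β m γ U =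
      polyFactor ρ β m (owner Γ cA) U * polyFactor ρ β m (Γ'.biUnion id) U := fun U => by
    rw [prod_polyFactor_eq_mul_erase ha, polyFactor_biUnion hΓ'c]
  set KA : Finset (Cell N) := (Finset.univ.filter fun c' : Cell N => cellDist cA c' ≤ 1) ∪ owner Γ cA with hKA
  have memKA : ∀ x ∈ KA, cellDist cA x ≤ 1 ∨ x ∈ owner Γ cA := fun x hx => by
    simpa [hKA, mem_union, mem_filter] using hx
  have hAR : ∀ x ∈ KA, ∀ y ∈ Γ'.biUnion id, 2 ≤ cellDist x y := fun x hx y hy => by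
    obtain ⟨γ, hγ, hyγ⟩ := mem_biUnion.1 hy
    obtain ⟨hγa, hγΓ⟩ := mem_erase.1 hγ
    exact two_le_cellDist_of_ne_owner hΓ (memKA x hx) hγΓ hγa hyγ
  have hFa : DependsOn (polyFactor (G := G) ρ β m (owner Γ cA)) (↑(KA.biUnion cellLinks) : Set (Edge 4 N)) :=
    (dependsOn_polyFactor _).mono (Finset.coe_subset.2 (biUnion_subset_biUnion_of_subset_left _ subset_union_right))
  have hAd : DependsOn A (↑(KA.biUnion cellLinks) : Set (Edge 4 N)) :=
    (dependsOn_block_of_blockEdges hA).mono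
      (Finset.coe_subset.2 (biUnion_subset_biUnion_of_subset_left _ subset_union_left))
  have hAFa : DependsOn (fun U => A U * polyFactor ρ β m (owner Γ cA) U) (↑(KA.biUnion cellLinks) : Set (Edge 4 N)) :=
    (dependsOn_mul hAd hFa).mono (Set.union_subset subset_rfl subset_rfl)
  have hR : DependsOn (polyFactor (G := G) ρ β m (Γ'.biUnion id)) (↑((Γ'.biUnion id).biUnion cellLinks) : Set (Edge 4 N)) :=
    dependsOn_polyFactor _
  have hFam := measurable_polyFactor (N := N) (β := β) (m := m) hρ (owner Γ cA)
  have hRm := measurable_polyFactor (N := N) (β := β) (m := m) hρ (Γ'.biUnion id)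
  have I1 := integral_mul_eq_of_dependsOn hAR hFa hFam hR hRm
  have I2 := integral_mul_eq_of_dependsOn hAR hAFa (hAm.mul hFam) hR hRm
  rw [mass_esSub_eq_integral hρ hm hW hΓ, integral_esSub hρ hm hW hΓ]
  simp_rw [hD]
  have e : ∀ U : GaugeConfig 4 N G, polyFactor ρ β m (owner Γ cA) U * polyFactor ρ β m (Γ'.biUnion id) U * A U =
      A U * polyFactor ρ β m (owner Γ cA) U * polyFactor ρ β m (Γ'.biUnion id) U := fun U => by ring
  simp_rw [e]
  rw [I1, I2]
  have hact : esAct (N := N) ρ β m (owner Γ cA) =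
      ∫ U, polyFactor ρ β m (owner Γ cA) U ∂(Measure.pi fun _ : Edge 4 N => haarProbability G) := rfl
  by_cases h0 : esAct (N := N) ρ β m (owner Γ cA) = 0
  · -- a vanishing activity kills the polymer factor almost everywhere
    have hint : Integrable (polyFactor ρ β m (owner Γ cA)) (Measure.pi fun _ : Edge 4 N => haarProbability G) :=
      Integrable.of_bound hFam.aestronglyMeasurable ((M / m - 1) ^ (owner Γ cA).card)
        (ae_of_all _ fun U => by
          rw [Real.norm_eq_abs, abs_of_nonneg (polyFactor_bounds hm hW _ U).1]
          exact (polyFactor_bounds hm hW _ U).2)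
    have hae : polyFactor ρ β m (owner Γ cA) =ᵐ[Measure.pi fun _ : Edge 4 N => haarProbability G] 0 :=
      (integral_eq_zero_iff_of_nonneg (fun U => (polyFactor_bounds hm hW _ U).1) hint).1 (hact ▸ h0)
    have hzero : ∫ U, A U * polyFactor ρ β m (owner Γ cA) U ∂(Measure.pi fun _ : Edge 4 N => haarProbability G) = 0 :=
      integral_eq_zero_of_ae (hae.mono fun U hU => by simp [hU])
    rw [hzero, ← hact, h0]
    simp
  · rw [← hact]
    field_simp

/-! ## §3 Assembly: `DPR` at mesh `1` from a floor and a ceiling, and the rung -/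

omit [NeZero N] in
/-- **`DPR ρ β S 1 p` from `m ≤ W_c ≤ M` with `0 ≤ M/m − 1 ≤ p`.** -/
theorem dpr_one_of_bounds (S : ℕ) (hρ : Continuous ρ) {M p : ℝ} (hm : 0 < m)
    (hW : ∀ (c : Cell (2 * S + 1)) (U : GaugeConfig 4 (2 * S + 1) G), m ≤ cellWeight ρ β c U ∧ cellWeight ρ β c U ≤ M)
    (hp0 : 0 ≤ M / m - 1) (hp : M / m - 1 ≤ p) : DPR ρ β S 1 p := by
  classical
  refine ⟨2 * S + 1, fun _ j => j, isGrid_unit, esAct (N := 2 * S + 1) ρ β m, esZ (N := 2 * S + 1) ρ β m,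
    esSub (N := 2 * S + 1) ρ β m, ?_, ?_, ?_, ?_, ?_, ?_, ?_⟩
  · exact lt_of_lt_of_le zero_lt_one
      (one_le_esZ hρ hm (fun c U => (hW c U).1) fun c U => cellFactor_le hm (hW c U).2)
  · intro γ
    obtain ⟨h0, h1⟩ := esAct_bounds hm hW γ
    exact ⟨h0, h1.trans (pow_le_pow_left₀ hp0 hp _)⟩
  · intro Γ hΓ; exact esSub_eq_zero_of_not_compatible hΓ
  · exact sum_esSub hρ hm hW
  · intro Γ hΓ; exact mass_esSub hρ hm hW hΓ
  · intro Γ hΓ cA cB A B hAm hBm _ _ hA hB h4 hown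
    exact esSub_indep hρ hm hW hΓ cA cB A B hAm hBm hA hB h4 hown
  · intro cA A hAm _ hA
    exact esSub_owner hρ hm hW cA A hAm hA

/-- **The strong-coupling rung of the es-polymer line** (`EsPolymer.ESRung`), proved: the registered stub `stub_esRung`
of `Cruxes/IR/Lines/es_polymer_decoupling.lean`, verbatim. -/
theorem stub_esRung : ESRung := by
  intro G _ _ _ _ _ _ n ρ hρ p hp
  -- a bound on `Re tr ρ`
  have hcont : Continuous fun g : G => (ρ g).trace.re := Complex.continuous_re.comp hρ.matrix_trace
  obtain ⟨B, hB⟩ := isCompact_univ.exists_bound_of_continuousOn hcont.continuousOn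
  have hB' : ∀ g : G, |(ρ g).trace.re| ≤ B := fun g => by simpa [Real.norm_eq_abs] using hB g (Set.mem_univ g)
  have hB0 : 0 ≤ B := (abs_nonneg _).trans (hB' 1)
  set κ : ℝ := Fintype.card {q : Fin 4 × Fin 4 // q.1 < q.2} * ((n : ℝ) + B) with hκ
  have hκ0 : 0 ≤ κ := by positivity
  have hlog : 0 < Real.log (1 + p) := Real.log_pos (by linarith)
  refine ⟨Real.log (1 + p) / (2 * κ + 1), div_pos hlog (by linarith), fun β hβ S => ?_⟩
  have h2D : 2 * (|β| * κ) ≤ Real.log (1 + p) := by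
    have h1 : |β| * (2 * κ + 1) ≤ Real.log (1 + p) := (le_div_iff₀ (by linarith)).1 hβ
    nlinarith [abs_nonneg β]
  have hMm : Real.exp (|β| * κ) / Real.exp (-(|β| * κ)) = Real.exp (2 * (|β| * κ)) := by
    rw [← Real.exp_sub]; ring_nf
  refine dpr_one_of_bounds S hρ (m := Real.exp (-(|β| * κ))) (M := Real.exp (|β| * κ)) (Real.exp_pos _)
    (fun c U => cellWeight_bounds ρ β hB' c U) ?_ ?_
  · rw [hMm, sub_nonneg]
    exact Real.one_le_exp (by positivity)
  · rw [hMm, sub_le_iff_le_add]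
    calc Real.exp (2 * (|β| * κ)) ≤ Real.exp (Real.log (1 + p)) := Real.exp_le_exp.2 h2D
      _ = p + 1 := by rw [Real.exp_log (by linarith), add_comm]

end Summit.QuantumFields.YangMills.Cruxes.IR.EsPolymer

end
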